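import Mathlib
import HarnessLib
import Literature.NumberTheory.LFunctions.RobertSargosFourthDerivative
import Literature.NumberTheory.LFunctions.RobertSargosTheorem1

/-!
# Discharge of `Sargos2003_lemma4` (the Robert–Sargos fourth-derivative test) — PROVED

Topic `Literature/NumberTheory/LFunctions`. This sibling of `RobertSargosFourthDerivative.lean`
proves the named fact recorded there,

* `Literature.NumberTheory.LFunctions.Sargos2003_lemma4_holds : Sargos2003_lemma4`,

i.e. **Sargos 2003, Lemma 4 in the case `u = 0` = Robert–Sargos 2002, Theorem 1** in Sargos's
normalisation: for `g ∈ C⁴[1, M]` with `λ₄ ≤ g⁽⁴⁾ ≤ C₀λ₄` on `[1, M]` (`M ≥ 10`, `0 < λ₄ ≤ 1/10`),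
`‖∑_{m=1}^{M} e(g(m))‖ ≤ C(C₀, ε) M^ε (M λ₄^{1/13} + λ₄^{-7/13})`.

The proof follows §4 of Robert–Sargos (Steps 0–7, formalized in `RobertSargosSteps123.lean`,
`RobertSargosStep4.lean`, `RobertSargosStep57.lean`, `RobertSargosTheorem1.lean` and their imports —
Theorem 2 = `RobertSargosDiophantine.lean`, Lemma 4 = `RobertSargosLemma4.lean`): the theorem for
derivative families `RobertSargos.Thm1.theorem1_family` is applied with `t = λ₄^{1/13}` to
`D j x = g^{(j)}(x + 2)` on `[0, M - 3]`, the iterated derivatives being taken within the open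
interval `(1, M)` (where the one-sided `C⁴` hypothesis on `[1, M]` gives honest derivatives, and
`iteratedDerivWithin 4 g (Icc 1 M) = iteratedDeriv 4 g` there); the three end terms `m = 1, 2, M`
are bounded trivially, `M - 2 ≤ M` absorbs the shift, and `C₀` is replaced by `max C₀ 1`.

## References

* O. Robert, P. Sargos, *A fourth derivative test for exponential sums*, Compositio Math. 130 (2002),
  275–292, doi:10.1023/A:1014363224308 = arXiv:2307.03562v1 — Theorem 1. [RobertSargos2002]
* P. Sargos, *An analog of van der Corput's `A⁴`-process for exponential sums*, Acta Arith. 110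
  (2003), 219–231, doi:10.4064/aa110-3-2 — Lemma 4, p. 226. [Sargos2003]
-/

noncomputable section

open Finset

namespace Literature.NumberTheory.LFunctions

open Literature.NumberTheory.LFunctions.VdC (e norm_e DerivFamily)
open Literature.NumberTheory.LFunctions.RobertSargos (sum_Ioc_eq_sum_range)
open Literature.NumberTheory.LFunctions.RobertSargos.Thm1 (theorem1_family)

set_option maxHeartbeats 2000000 in
/-- **Sargos 2003, Lemma 4 (`u = 0`) = Robert–Sargos 2002, Theorem 1**: the discharge of the named
fact `Sargos2003_lemma4`, from `RobertSargos.Thm1.theorem1_family` (see the module docstring).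
[cite: Sargos2003, Lemma 4] [cite: RobertSargos2002, Theorem 1] -/
theorem Sargos2003_lemma4_holds : Sargos2003_lemma4 := by
  intro C₀ ε hε
  have exp_two_pi_eq_e : ∀ x : ℝ, Complex.exp (2 * ↑Real.pi * Complex.I * ↑x) = e x := by
    intro x
    rw [Literature.NumberTheory.LFunctions.VdC.e]
    congr 1
    push_cast
    ring
  obtain ⟨C, hC0, hC⟩ := theorem1_family (max C₀ 1) (le_max_right _ _) (half_pos hε)
  refine ⟨3 + C, ?_⟩
  intro M hM lam hlam hlam1 g hg hb
  -- `t = λ^{1/13}`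
  have hlam_le1 : lam ≤ 1 := by linarith
  set t : ℝ := lam ^ (1 / 13 : ℝ) with ht_def
  have ht : 0 < t := Real.rpow_pos_of_pos hlam _
  have ht1 : t ≤ 1 := Real.rpow_le_one hlam.le hlam_le1 (by norm_num)
  have ht13 : t ^ 13 = lam := by
    rw [ht_def, ← Real.rpow_natCast, ← Real.rpow_mul hlam.le]; norm_num
  have ht7 : t ^ 7 = lam ^ (7 / 13 : ℝ) := by
    rw [ht_def, ← Real.rpow_natCast, ← Real.rpow_mul hlam.le]; norm_num
  have hMr : (10 : ℝ) ≤ M := by exact_mod_cast hM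
  -- the open interval and the family
  set U : Set ℝ := Set.Ioo (1 : ℝ) M with hU
  have hUopen : IsOpen U := isOpen_Ioo
  have hgU : ContDiffOn ℝ 4 g U := hg.mono Set.Ioo_subset_Icc_self
  set L : ℕ := M - 3 with hL
  have hL3 : 3 ≤ M := by omega
  have hLr : (L : ℝ) = M - 3 := by rw [hL]; push_cast [Nat.cast_sub hL3]; ring
  set D : ℕ → ℝ → ℝ := fun j x => iteratedDerivWithin j g U (x + 2) with hD
  have hmemU : ∀ x ∈ Set.Icc (0 : ℝ) L, x + 2 ∈ U := by
    intro x hx; rw [hLr] at hx; rw [hU]; exact ⟨by linarith [hx.1], by linarith [hx.2]⟩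
  have hDf : DerivFamily D 0 L 4 := by
    intro j hj x hx
    have hy := hmemU x hx
    have hjn : (j : WithTop ℕ∞) < 4 := by exact_mod_cast hj
    have hdiff : DifferentiableAt ℝ (iteratedDerivWithin j g U) (x + 2) :=
      ((hgU.differentiableOn_iteratedDerivWithin hjn (uniqueDiffOn_Ioo 1 M)) (x + 2) hy).differentiableAt
        (hUopen.mem_nhds hy)
    have h1 : HasDerivAt (iteratedDerivWithin j g U) (iteratedDerivWithin (j + 1) g U (x + 2)) (x + 2) := by
      have h2 := hdiff.hasDerivAt
      rw [iteratedDerivWithin_succ, derivWithin_of_isOpen hUopen hy]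
      exact h2
    exact h1.comp_add_const x 2
  have hb4 : ∀ x ∈ Set.Icc (0 : ℝ) L, t ^ 13 ≤ D 4 x ∧ D 4 x ≤ max C₀ 1 * t ^ 13 := by
    intro x hx
    have hy := hmemU x hx
    have hyI : x + 2 ∈ Set.Icc (1 : ℝ) M := Set.Ioo_subset_Icc_self hy
    have e1 : D 4 x = iteratedDeriv 4 g (x + 2) := iteratedDerivWithin_of_isOpen hUopen hy
    have e2 : iteratedDerivWithin 4 g (Set.Icc 1 M) (x + 2) = iteratedDeriv 4 g (x + 2) :=
      iteratedDerivWithin_eq_iteratedDeriv (uniqueDiffOn_Icc (by linarith))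
        (hg.contDiffAt (Icc_mem_nhds hy.1 hy.2)) hyI
    obtain ⟨hlo, hhi⟩ := hb (x + 2) hyI
    rw [e2] at hlo hhi
    rw [e1, ht13]
    refine ⟨hlo, hhi.trans ?_⟩
    exact mul_le_mul_of_nonneg_right (le_max_left _ _) hlam.le
  have key := hC t ht ht1 L D hDf hb4
  -- the sums: `∑_{m=1}^{M} = (m = 1, 2) + ∑_{2 < m ≤ M-1} + (m = M)`
  set F : ℕ → ℂ := fun m => Complex.exp (2 * ↑Real.pi * Complex.I * ↑(g m)) with hF
  have hF1 : ∀ m, ‖F m‖ = 1 := by intro m; rw [hF]; simp only; rw [exp_two_pi_eq_e, norm_e]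
  have hIcc : Finset.Icc 1 M = Finset.Ioc 0 M := by
    ext m; simp only [Finset.mem_Icc, Finset.mem_Ioc]; omega
  have hsplit : ∑ m ∈ Finset.Icc 1 M, F m =
      ∑ m ∈ Finset.Ioc 0 2, F m + ∑ m ∈ Finset.Ioc 2 (M - 1), F m + ∑ m ∈ Finset.Ioc (M - 1) M, F m := by
    rw [hIcc, Finset.sum_Ioc_consecutive F (by omega : 0 ≤ 2) (by omega : 2 ≤ M - 1),
      Finset.sum_Ioc_consecutive F (by omega : 0 ≤ M - 1) (by omega : M - 1 ≤ M)]
  have hnorm_le_card : ∀ a b : ℕ, ‖∑ m ∈ Finset.Ioc a b, F m‖ ≤ (b - a : ℕ) := by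
    intro a b
    calc ‖∑ m ∈ Finset.Ioc a b, F m‖ ≤ ∑ m ∈ Finset.Ioc a b, ‖F m‖ := norm_sum_le _ _
      _ = ∑ m ∈ Finset.Ioc a b, (1 : ℝ) := Finset.sum_congr rfl fun m _ => hF1 m
      _ = (b - a : ℕ) := by rw [Finset.sum_const, Nat.card_Ioc, nsmul_eq_mul, mul_one]
  -- the middle sum equals the family sum
  have hmid : ∑ m ∈ Finset.Ioc 2 (M - 1), F m = ∑ n ∈ Finset.Ioc (0 : ℤ) L, e (D 0 n) := by
    have h1 : Finset.Ioc 2 (M - 1) = Finset.Ico 3 M := by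
      ext m; simp only [Finset.mem_Ioc, Finset.mem_Ico]; omega
    rw [h1, Finset.sum_Ico_eq_sum_range, show M - 3 = L from rfl]
    rw [show (L : ℤ) = 0 + (L : ℤ) by ring, sum_Ioc_eq_sum_range]
    refine Finset.sum_congr rfl fun i _ => ?_
    rw [hF, hD]; simp only
    rw [exp_two_pi_eq_e, iteratedDerivWithin_zero]
    congr 2
    push_cast; ring
  have hmain : ‖∑ m ∈ Finset.Icc 1 M, F m‖ ≤ 3 + ‖∑ n ∈ Finset.Ioc (0 : ℤ) L, e (D 0 n)‖ := by
    rw [hsplit, ← hmid]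
    have h1 := hnorm_le_card 0 2
    have h2 := hnorm_le_card (M - 1) M
    have h3 : ((M - (M - 1) : ℕ) : ℝ) = 1 := by rw [show M - (M - 1) = 1 by omega]; simp
    rw [h3] at h2
    norm_num at h1
    calc _ ≤ ‖∑ m ∈ Finset.Ioc 0 2, F m + ∑ m ∈ Finset.Ioc 2 (M - 1), F m‖ + ‖∑ m ∈ Finset.Ioc (M - 1) M, F m‖ :=
          norm_add_le _ _
      _ ≤ (‖∑ m ∈ Finset.Ioc 0 2, F m‖ + ‖∑ m ∈ Finset.Ioc 2 (M - 1), F m‖) + ‖∑ m ∈ Finset.Ioc (M - 1) M, F m‖ :=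
          add_le_add (norm_add_le _ _) le_rfl
      _ ≤ (2 + ‖∑ m ∈ Finset.Ioc 2 (M - 1), F m‖) + 1 := by linarith
      _ = _ := by ring
  -- the final numerics
  have hMε : (1 : ℝ) ≤ (M : ℝ) ^ ε := Real.one_le_rpow (by linarith) hε.le
  have hlam7 : (1 : ℝ) ≤ lam ^ (-(7 / 13 : ℝ)) :=
    Real.one_le_rpow_of_pos_of_le_one_of_nonpos hlam hlam_le1 (by norm_num)
  have hL1ε : ((L : ℝ) + 1) ^ (2 * (ε / 2)) ≤ (M : ℝ) ^ ε := by
    rw [show 2 * (ε / 2) = ε by ring]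
    exact Real.rpow_le_rpow (by positivity) (by rw [hLr]; linarith) hε.le
  have hLt : (L : ℝ) * t ≤ (M : ℝ) * lam ^ (1 / 13 : ℝ) := by
    rw [← ht_def]; exact mul_le_mul_of_nonneg_right (by rw [hLr]; linarith) ht.le
  have hinv7 : 1 / t ^ 7 = lam ^ (-(7 / 13 : ℝ)) := by
    rw [ht7, Real.rpow_neg hlam.le, one_div]
  have hpos1 : 0 ≤ (M : ℝ) * lam ^ (1 / 13 : ℝ) := by positivity
  have hpos2 : 0 ≤ (M : ℝ) ^ ε := by positivity
  calc ‖∑ m ∈ Finset.Icc 1 M, Complex.exp (2 * ↑Real.pi * Complex.I * ↑(g m))‖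
      = ‖∑ m ∈ Finset.Icc 1 M, F m‖ := by rw [hF]
    _ ≤ 3 + ‖∑ n ∈ Finset.Ioc (0 : ℤ) L, e (D 0 n)‖ := hmain
    _ ≤ 3 + C * ((L : ℝ) + 1) ^ (2 * (ε / 2)) * ((L : ℝ) * t + 1 / t ^ 7) := by linarith [key]
    _ ≤ 3 + C * (M : ℝ) ^ ε * ((M : ℝ) * lam ^ (1 / 13 : ℝ) + lam ^ (-(7 / 13 : ℝ))) := by
        rw [hinv7]
        have i1 : (L : ℝ) * t + lam ^ (-(7 / 13 : ℝ)) ≤ (M : ℝ) * lam ^ (1 / 13 : ℝ) + lam ^ (-(7 / 13 : ℝ)) := by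
          linarith
        have i0 : 0 ≤ (L : ℝ) * t + lam ^ (-(7 / 13 : ℝ)) := by positivity
        have := mul_le_mul hL1ε i1 i0 hpos2
        nlinarith only [this, hC0]
    _ ≤ (3 + C) * (M : ℝ) ^ ε * ((M : ℝ) * lam ^ (1 / 13 : ℝ) + lam ^ (-(7 / 13 : ℝ))) := by
        have : (1 : ℝ) ≤ (M : ℝ) ^ ε * ((M : ℝ) * lam ^ (1 / 13 : ℝ) + lam ^ (-(7 / 13 : ℝ))) := by
          calc (1 : ℝ) = 1 * (0 + 1) := by ring
            _ ≤ (M : ℝ) ^ ε * ((M : ℝ) * lam ^ (1 / 13 : ℝ) + lam ^ (-(7 / 13 : ℝ))) :=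
                mul_le_mul hMε (add_le_add hpos1 hlam7) (by norm_num) hpos2
        nlinarith only [this, hC0]

end Literature.NumberTheory.LFunctions

end
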